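/-
Copyright: the b2b-balaban T⁴-continuum CRUX team, row NE7b leaf lineage `t4-ne7b-formalise-leaf-02` (gen 134). Project licence.
-/
import Summits.QuantumFields.BalabanUV.T4Continuum.Spine.NE7b.TorusPlaquetteIncidence
import Literature.MathematicalPhysics.QuantumFieldTheory.Balaban1983to89.B7Prop3GeneralRotated

/-!
# THE COVARIANT CURL OF THE UNIT TORUS AS A FAMILY OF LINEAR LOCAL TERMS: `(∂_V B)(P) = Σ_{c ∈ bonds(P)} R_{P,c}(B c)` with `R_{P,c} ∈ {id, R(w₁), −R(w₂), −R(w₃)}`,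
# `‖R_{P,c}v‖ ≤ ‖v‖` for transports in the unit-ball class — the `(inc, R, ℓ = 1)` data of `…AdmissibleFloorSeminormTerms.ims_floor_of_linear_terms` for the
# CURL TERMS, over `…TorusPlaquetteIncidence`'s plaquette-to-bonds map (row NE7b, node U5c; residual (R2′) family (2), letter (ℓ1); E-side bookkeeping)

Cell `pub-balaban`, sub-cell `t4`, spine estimate NE7b (`T4WeightBudget.RelWeightBound`; the cell's OWN estimate — NOT PRINTED in [Bałaban 1983–89],
NOT PROVED).  Crux-route work under `Spine/NE7b/`; NOTHING of Bałaban's is asserted; no `def`; zero `sorry`; no `T4Continuum/Support` leaf (FREEZE (0)).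
Imports: this lineage's `…TorusPlaquetteIncidence` (TPI: `ι`∕`hι`, `plaquetteBonds_injective`) and `Literature.….B7Prop3GeneralRotated` (`norm_conjR_le`; through
it `B7Eq78Linearization.conjR`, `conjR_add`, `conjR_smul_real` — the rotation `R(w)Z = wZw⁻¹` IS `ℝ`-linear, so `LinearMap.mk ⟨conjR w, conjR_add w⟩
(conjR_smul_real w) : 𝔸 →ₗ[ℝ] 𝔸` is written inline, no `def`).

WHY.  The (h2) slot's IMS floor (AFST `ims_floor_of_linear_terms`, and its partition-fed forms `…TentPartitionFloor` ∕ `…SineTentFloor`) displays the local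
terms as `T_j x = Σ_{c ∈ inc j} R_{j,c}(x c)` with `R_{j,c} : W →ₗ[ℝ] V`, `‖R_{j,c}v‖ ≤ ℓ‖v‖`.  For the CURL TERMS at k = 1 (`…CoarseCurlTransportLetters`'
`X_P(B) = ‖B(y,μ) + R(w₁)B(y+e_μ,ν) − R(w₂)B(y+e_ν,μ) − R(w₃)B(y,ν)‖`, transports `w_i` in the unit-ball class `U1`) this file supplies that shape: `inc P :=
image (ι P)` (TPI; `a = 4` by `…AveragedCurlFormSplit.card_image_four_le`, `b = 2(d−1)` by TPI `card_plaquettes_through_bond_le`), the maps `R_{P,c}` by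
position in the plaquette (characterised by the hypothesis `hR`, inhabited by `exists_curlMaps`), `ℓ = 1`, and the identity `Σ_{c∈inc P} R_{P,c}(B c) =` the
covariant curl — for ANY three transports per plaquette (the (A3) choice of `w` is the consumer's; CCTL's `V̄₀`-products are one instance).

WHAT IS PROVED ([folklore]; `w : plaquettes → Fin 3 → 𝔸ˣ`; `R` characterised by `hR`):
* §1 `exists_curlMaps` (the family `R` exists); **`norm_curlMap_le`** (`‖R_{P,c}v‖ ≤ 1·‖v‖` for `w_i ∈ U1` — AFST's `hR` with `ℓ = 1`; off the plaquette `R_{P,c} = 0`).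
* §2 **`sum_curlMaps_eq`** (`1 < M`): `Σ_{c ∈ image (ι P)} R_{P,c}(B c) = B(ι P 0) + R(w₀)B(ι P 1) − R(w₁)B(ι P 2) − R(w₂)B(ι P 3)` (the four bonds are distinct:
  TPI `plaquetteBonds_injective`, `Finset.sum_image`, `Fin.sum_univ_four`).
* §3 **`norm_sum_curlMaps_eq`** — for a curl functional `X` characterised by `hX : X (y,a) B = ‖B y μ + R(w₀)(B (y+e_μ) ν) − R(w₁)(B (y+e_ν) μ) − R(w₂)(B y ν)‖`
  (CCTL's `hX` with its transports abstracted to `w`): `‖Σ_{c∈image (ι P)} R_{P,c}(B c.1 c.2)‖ = X P B`; `sum_sq_norm_curlMaps_eq` (summed over plaquettes: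
  AFST's `Σ_j‖T_j x‖²` IS `Σ_P X_P(B)²`).
* §4 toy: `d = 2`, `M = 3`, all transports `1`: the sum of the four maps on a constant field vanishes (`example`).

NOT HERE (honest): which transports `w` print's (A3) prescribes at step k (CCTL: `V̄₀`-products at k = 1), the local floors, the average terms; anything of
Bałaban's.  BY-NAME EFFECT ON THE WALL: NONE.  NE7b NOT PRINTED ∕ NOT PROVED; spine PROVED 0∕9; rung (B)+1 on ONE finite T⁴ — NOT infinite volume, NOT the
mass gap, NOT Clay.
HONEST DEPENDENCY: continuum YM on T⁴ ⇐ BetaPertH ∧ nine spine estimates (0/9 proved); BetaPertH ⇐ (D1) ∧ (D4) ∧ CAP+tail; G-an2-4 gates asym, D1 and NE2/3/4.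
-/

set_option autoImplicit false

noncomputable section

open Finset
open Literature.MathematicalPhysics.QuantumFieldTheory.Balaban1983to89.B7Prop1Explicit (U1)
open Literature.MathematicalPhysics.QuantumFieldTheory.Balaban1983to89.B7Eq78Linearization (conjR conjR_add conjR_smul_real)
open Literature.MathematicalPhysics.QuantumFieldTheory.Balaban1983to89.B7Prop3GeneralRotated (norm_conjR_le)
open Summit.QuantumFields.BalabanUV.T4Continuum.NE7b.TorusPlaquetteIncidence (plaquetteBonds_injective)

namespace Summit.QuantumFields.BalabanUV.T4Continuum.NE7b.CurlTermsLinear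

variable {d M : ℕ}
variable {𝔸 : Type*} [NormedRing 𝔸] [NormedAlgebra ℂ 𝔸] [NormOneClass 𝔸] [CompleteSpace 𝔸]

/-! ## §1 The four maps of a plaquette and their size -/

omit [NormOneClass 𝔸] [CompleteSpace 𝔸] in
/-- THE CURL MAPS EXIST: position `0 ↦ id`, `1 ↦ R(w₀)`, `2 ↦ −R(w₁)`, `3 ↦ −R(w₂)`, any other bond `↦ 0`. [folklore] -/
theorem exists_curlMaps
    (ι : (Fin d → ZMod M) × {a : Fin d × Fin d // a.1 < a.2} → Fin 4 → (Fin d → ZMod M) × Fin d)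
    (w : (Fin d → ZMod M) × {a : Fin d × Fin d // a.1 < a.2} → Fin 3 → 𝔸ˣ) :
    ∃ R : (Fin d → ZMod M) × {a : Fin d × Fin d // a.1 < a.2} → (Fin d → ZMod M) × Fin d → 𝔸 →ₗ[ℝ] 𝔸,
      ∀ P c, R P c =
        if c = ι P 0 then LinearMap.id
        else if c = ι P 1 then LinearMap.mk ⟨conjR (w P 0), conjR_add (w P 0)⟩ (conjR_smul_real (w P 0))
        else if c = ι P 2 then -LinearMap.mk ⟨conjR (w P 1), conjR_add (w P 1)⟩ (conjR_smul_real (w P 1))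
        else if c = ι P 3 then -LinearMap.mk ⟨conjR (w P 2), conjR_add (w P 2)⟩ (conjR_smul_real (w P 2))
        else 0 :=
  ⟨fun P c =>
      if c = ι P 0 then LinearMap.id
      else if c = ι P 1 then LinearMap.mk ⟨conjR (w P 0), conjR_add (w P 0)⟩ (conjR_smul_real (w P 0))
      else if c = ι P 2 then -LinearMap.mk ⟨conjR (w P 1), conjR_add (w P 1)⟩ (conjR_smul_real (w P 1))
      else if c = ι P 3 then -LinearMap.mk ⟨conjR (w P 2), conjR_add (w P 2)⟩ (conjR_smul_real (w P 2))
      else 0,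
    fun _ _ => rfl⟩

omit [CompleteSpace 𝔸] in
/-- **`‖R_{P,c} v‖ ≤ 1·‖v‖`** for transports in the unit-ball class (`‖R(w)Z‖ ≤ ‖Z‖`, `norm_conjR_le`; `id`, `0`) — AFST's `hR` with `ℓ = 1`. [folklore] -/
theorem norm_curlMap_le
    (ι : (Fin d → ZMod M) × {a : Fin d × Fin d // a.1 < a.2} → Fin 4 → (Fin d → ZMod M) × Fin d)
    (w : (Fin d → ZMod M) × {a : Fin d × Fin d // a.1 < a.2} → Fin 3 → 𝔸ˣ) (hw : ∀ P i, w P i ∈ U1 𝔸)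
    (R : (Fin d → ZMod M) × {a : Fin d × Fin d // a.1 < a.2} → (Fin d → ZMod M) × Fin d → 𝔸 →ₗ[ℝ] 𝔸)
    (hR : ∀ P c, R P c =
        if c = ι P 0 then LinearMap.id
        else if c = ι P 1 then LinearMap.mk ⟨conjR (w P 0), conjR_add (w P 0)⟩ (conjR_smul_real (w P 0))
        else if c = ι P 2 then -LinearMap.mk ⟨conjR (w P 1), conjR_add (w P 1)⟩ (conjR_smul_real (w P 1))
        else if c = ι P 3 then -LinearMap.mk ⟨conjR (w P 2), conjR_add (w P 2)⟩ (conjR_smul_real (w P 2))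
        else 0)
    (P : (Fin d → ZMod M) × {a : Fin d × Fin d // a.1 < a.2}) (c : (Fin d → ZMod M) × Fin d) (v : 𝔸) :
    ‖R P c v‖ ≤ 1 * ‖v‖ := by
  rw [hR, one_mul]
  split_ifs
  · exact le_rfl
  · exact norm_conjR_le (hw P 0) v
  · rw [LinearMap.neg_apply, norm_neg]; exact norm_conjR_le (hw P 1) v
  · rw [LinearMap.neg_apply, norm_neg]; exact norm_conjR_le (hw P 2) v
  · rw [LinearMap.zero_apply, norm_zero]; exact norm_nonneg _

/-! ## §2 The sum over the bonds of a plaquette is the covariant curl -/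

omit [NormOneClass 𝔸] [CompleteSpace 𝔸] in
/-- **`Σ_{c ∈ image (ι P)} R_{P,c}(B c) = B(ι P 0) + R(w₀)B(ι P 1) − R(w₁)B(ι P 2) − R(w₂)B(ι P 3)`** (`1 < M`: the four bonds of a plaquette are distinct, TPI
`plaquetteBonds_injective`). [folklore] -/
theorem sum_curlMaps_eq [Fact (1 < M)]
    (ι : (Fin d → ZMod M) × {a : Fin d × Fin d // a.1 < a.2} → Fin 4 → (Fin d → ZMod M) × Fin d)
    (hι : ∀ x a, ι (x, a) = ![(x, a.1.1), (x + Pi.single a.1.1 1, a.1.2), (x + Pi.single a.1.2 1, a.1.1), (x, a.1.2)])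
    (w : (Fin d → ZMod M) × {a : Fin d × Fin d // a.1 < a.2} → Fin 3 → 𝔸ˣ)
    (R : (Fin d → ZMod M) × {a : Fin d × Fin d // a.1 < a.2} → (Fin d → ZMod M) × Fin d → 𝔸 →ₗ[ℝ] 𝔸)
    (hR : ∀ P c, R P c =
        if c = ι P 0 then LinearMap.id
        else if c = ι P 1 then LinearMap.mk ⟨conjR (w P 0), conjR_add (w P 0)⟩ (conjR_smul_real (w P 0))
        else if c = ι P 2 then -LinearMap.mk ⟨conjR (w P 1), conjR_add (w P 1)⟩ (conjR_smul_real (w P 1))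
        else if c = ι P 3 then -LinearMap.mk ⟨conjR (w P 2), conjR_add (w P 2)⟩ (conjR_smul_real (w P 2))
        else 0)
    (P : (Fin d → ZMod M) × {a : Fin d × Fin d // a.1 < a.2}) (B : (Fin d → ZMod M) × Fin d → 𝔸) :
    ∑ c ∈ Finset.univ.image (ι P), R P c (B c)
      = B (ι P 0) + conjR (w P 0) (B (ι P 1)) - conjR (w P 1) (B (ι P 2)) - conjR (w P 2) (B (ι P 3)) := by
  classical
  obtain ⟨x, a⟩ := P
  have hinj := plaquetteBonds_injective ι hι (x, a)
  rw [Finset.sum_image hinj.injOn, Fin.sum_univ_four]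
  have h10 : ι (x, a) 1 ≠ ι (x, a) 0 := hinj.ne (by decide)
  have h20 : ι (x, a) 2 ≠ ι (x, a) 0 := hinj.ne (by decide)
  have h21 : ι (x, a) 2 ≠ ι (x, a) 1 := hinj.ne (by decide)
  have h30 : ι (x, a) 3 ≠ ι (x, a) 0 := hinj.ne (by decide)
  have h31 : ι (x, a) 3 ≠ ι (x, a) 1 := hinj.ne (by decide)
  have h32 : ι (x, a) 3 ≠ ι (x, a) 2 := hinj.ne (by decide)
  have e0 : R (x, a) (ι (x, a) 0) (B (ι (x, a) 0)) = B (ι (x, a) 0) := by rw [hR, if_pos rfl]; rfl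
  have e1 : R (x, a) (ι (x, a) 1) (B (ι (x, a) 1)) = conjR (w (x, a) 0) (B (ι (x, a) 1)) := by
    rw [hR, if_neg h10, if_pos rfl]; rfl
  have e2 : R (x, a) (ι (x, a) 2) (B (ι (x, a) 2)) = -conjR (w (x, a) 1) (B (ι (x, a) 2)) := by
    rw [hR, if_neg h20, if_neg h21, if_pos rfl]; rfl
  have e3 : R (x, a) (ι (x, a) 3) (B (ι (x, a) 3)) = -conjR (w (x, a) 2) (B (ι (x, a) 3)) := by
    rw [hR, if_neg h30, if_neg h31, if_neg h32, if_pos rfl]; rfl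
  rw [e0, e1, e2, e3]
  abel

/-! ## §3 … so `‖T_P B‖` is the curl functional -/

omit [NormOneClass 𝔸] [CompleteSpace 𝔸] in
/-- **AFST's `‖T_P x‖` IS THE CURL FUNCTIONAL**: for `X` characterised by `hX` (CCTL's shape, transports abstracted to `w`) and the bond field read as
`x c := B c.1 c.2`: `‖Σ_{c∈image (ι P)} R_{P,c}(B c.1 c.2)‖ = X P B` (`1 < M`). [folklore] -/
theorem norm_sum_curlMaps_eq [Fact (1 < M)]
    (ι : (Fin d → ZMod M) × {a : Fin d × Fin d // a.1 < a.2} → Fin 4 → (Fin d → ZMod M) × Fin d)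
    (hι : ∀ x a, ι (x, a) = ![(x, a.1.1), (x + Pi.single a.1.1 1, a.1.2), (x + Pi.single a.1.2 1, a.1.1), (x, a.1.2)])
    (w : (Fin d → ZMod M) × {a : Fin d × Fin d // a.1 < a.2} → Fin 3 → 𝔸ˣ)
    (R : (Fin d → ZMod M) × {a : Fin d × Fin d // a.1 < a.2} → (Fin d → ZMod M) × Fin d → 𝔸 →ₗ[ℝ] 𝔸)
    (hR : ∀ P c, R P c =
        if c = ι P 0 then LinearMap.id
        else if c = ι P 1 then LinearMap.mk ⟨conjR (w P 0), conjR_add (w P 0)⟩ (conjR_smul_real (w P 0))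
        else if c = ι P 2 then -LinearMap.mk ⟨conjR (w P 1), conjR_add (w P 1)⟩ (conjR_smul_real (w P 1))
        else if c = ι P 3 then -LinearMap.mk ⟨conjR (w P 2), conjR_add (w P 2)⟩ (conjR_smul_real (w P 2))
        else 0)
    (X : (Fin d → ZMod M) × {a : Fin d × Fin d // a.1 < a.2} → ((Fin d → ZMod M) → Fin d → 𝔸) → ℝ)
    (hX : ∀ (y : Fin d → ZMod M) (a : {a : Fin d × Fin d // a.1 < a.2}) (B : (Fin d → ZMod M) → Fin d → 𝔸), X (y, a) B =
      ‖B y a.1.1 + conjR (w (y, a) 0) (B (y + Pi.single a.1.1 1) a.1.2) - conjR (w (y, a) 1) (B (y + Pi.single a.1.2 1) a.1.1)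
        - conjR (w (y, a) 2) (B y a.1.2)‖)
    (P : (Fin d → ZMod M) × {a : Fin d × Fin d // a.1 < a.2}) (B : (Fin d → ZMod M) → Fin d → 𝔸) :
    ‖∑ c ∈ Finset.univ.image (ι P), R P c (B c.1 c.2)‖ = X P B := by
  obtain ⟨y, a⟩ := P
  rw [sum_curlMaps_eq ι hι w R hR (y, a) (fun c => B c.1 c.2), hX, hι]
  rfl

omit [NormOneClass 𝔸] [CompleteSpace 𝔸] in
/-- … summed over the plaquettes: `Σ_P ‖T_P x‖² = Σ_P X_P(B)²` — AFST's `hF` ∕ `hloc` left-hand sides ARE the curl form. [folklore] -/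
theorem sum_sq_norm_curlMaps_eq [Fact (1 < M)] [NeZero M]
    (ι : (Fin d → ZMod M) × {a : Fin d × Fin d // a.1 < a.2} → Fin 4 → (Fin d → ZMod M) × Fin d)
    (hι : ∀ x a, ι (x, a) = ![(x, a.1.1), (x + Pi.single a.1.1 1, a.1.2), (x + Pi.single a.1.2 1, a.1.1), (x, a.1.2)])
    (w : (Fin d → ZMod M) × {a : Fin d × Fin d // a.1 < a.2} → Fin 3 → 𝔸ˣ)
    (R : (Fin d → ZMod M) × {a : Fin d × Fin d // a.1 < a.2} → (Fin d → ZMod M) × Fin d → 𝔸 →ₗ[ℝ] 𝔸)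
    (hR : ∀ P c, R P c =
        if c = ι P 0 then LinearMap.id
        else if c = ι P 1 then LinearMap.mk ⟨conjR (w P 0), conjR_add (w P 0)⟩ (conjR_smul_real (w P 0))
        else if c = ι P 2 then -LinearMap.mk ⟨conjR (w P 1), conjR_add (w P 1)⟩ (conjR_smul_real (w P 1))
        else if c = ι P 3 then -LinearMap.mk ⟨conjR (w P 2), conjR_add (w P 2)⟩ (conjR_smul_real (w P 2))
        else 0)
    (X : (Fin d → ZMod M) × {a : Fin d × Fin d // a.1 < a.2} → ((Fin d → ZMod M) → Fin d → 𝔸) → ℝ)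
    (hX : ∀ (y : Fin d → ZMod M) (a : {a : Fin d × Fin d // a.1 < a.2}) (B : (Fin d → ZMod M) → Fin d → 𝔸), X (y, a) B =
      ‖B y a.1.1 + conjR (w (y, a) 0) (B (y + Pi.single a.1.1 1) a.1.2) - conjR (w (y, a) 1) (B (y + Pi.single a.1.2 1) a.1.1)
        - conjR (w (y, a) 2) (B y a.1.2)‖)
    (B : (Fin d → ZMod M) → Fin d → 𝔸) :
    ∑ P, ‖∑ c ∈ Finset.univ.image (ι P), R P c (B c.1 c.2)‖ ^ 2 = ∑ P, X P B ^ 2 :=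
  Finset.sum_congr rfl fun P _ => by rw [norm_sum_curlMaps_eq ι hι w R hR X hX P B]

/-! ## §4 Toy: `d = 2`, `M = 3`, trivial transports, a constant field -/

/- With all three transports `1` the covariant curl of the constant field `B ≡ Z` is `Z + Z − Z − Z = 0` (`R(1)Z = Z`). -/
example (Z : 𝔸) (R : (Fin 2 → ZMod 3) × {a : Fin 2 × Fin 2 // a.1 < a.2} → (Fin 2 → ZMod 3) × Fin 2 → 𝔸 →ₗ[ℝ] 𝔸)
    (hR : ∀ P c, R P c =
        if c = (fun (q : (Fin 2 → ZMod 3) × {a : Fin 2 × Fin 2 // a.1 < a.2}) =>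
            ![(q.1, q.2.1.1), (q.1 + Pi.single q.2.1.1 1, q.2.1.2), (q.1 + Pi.single q.2.1.2 1, q.2.1.1), (q.1, q.2.1.2)]) P 0 then LinearMap.id
        else if c = (fun (q : (Fin 2 → ZMod 3) × {a : Fin 2 × Fin 2 // a.1 < a.2}) =>
            ![(q.1, q.2.1.1), (q.1 + Pi.single q.2.1.1 1, q.2.1.2), (q.1 + Pi.single q.2.1.2 1, q.2.1.1), (q.1, q.2.1.2)]) P 1
          then LinearMap.mk ⟨conjR ((fun _ _ => (1 : 𝔸ˣ)) P 0), conjR_add _⟩ (conjR_smul_real _)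
        else if c = (fun (q : (Fin 2 → ZMod 3) × {a : Fin 2 × Fin 2 // a.1 < a.2}) =>
            ![(q.1, q.2.1.1), (q.1 + Pi.single q.2.1.1 1, q.2.1.2), (q.1 + Pi.single q.2.1.2 1, q.2.1.1), (q.1, q.2.1.2)]) P 2
          then -LinearMap.mk ⟨conjR ((fun _ _ => (1 : 𝔸ˣ)) P 1), conjR_add _⟩ (conjR_smul_real _)
        else if c = (fun (q : (Fin 2 → ZMod 3) × {a : Fin 2 × Fin 2 // a.1 < a.2}) =>
            ![(q.1, q.2.1.1), (q.1 + Pi.single q.2.1.1 1, q.2.1.2), (q.1 + Pi.single q.2.1.2 1, q.2.1.1), (q.1, q.2.1.2)]) P 3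
          then -LinearMap.mk ⟨conjR ((fun _ _ => (1 : 𝔸ˣ)) P 2), conjR_add _⟩ (conjR_smul_real _)
        else 0)
    (P : (Fin 2 → ZMod 3) × {a : Fin 2 × Fin 2 // a.1 < a.2}) :
    ∑ c ∈ Finset.univ.image ((fun (q : (Fin 2 → ZMod 3) × {a : Fin 2 × Fin 2 // a.1 < a.2}) =>
        ![(q.1, q.2.1.1), (q.1 + Pi.single q.2.1.1 1, q.2.1.2), (q.1 + Pi.single q.2.1.2 1, q.2.1.1), (q.1, q.2.1.2)]) P), R P c ((fun _ => Z) c) = 0 := by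
  haveI : Fact (1 < 3) := ⟨by norm_num⟩
  rw [sum_curlMaps_eq _ (fun _ _ => rfl) (fun _ _ => (1 : 𝔸ˣ)) R hR P (fun _ => Z)]
  simp only [conjR, Units.val_one, inv_one, one_mul, mul_one]
  abel

end Summit.QuantumFields.BalabanUV.T4Continuum.NE7b.CurlTermsLinear

end
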